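import Summits.Ventures.PercRepro.RankDistDirectSumTop
import Summits.Ventures.PercRepro.RankDistTightBiIndep

/-!
# PercRepro — TOP FROM THE COMPLEMENTS OF THE BOTTOM SETS: `#𝓑 ≤ s_p` on every tight layer, TOP when the bottom sets
are closed, and the paving cells satisfy (SC) with TOP — so their direct sums satisfy (SC) and C-025 (p9, gen 22)

Tight layer `|E| = p + q`, `ρ(E) = p`. The complement `E ∖ B` of a bottom set `B` is a base; it CONTAINS a bottom
set — the complement of any base `B'' ⊇ B` (`exists_mem_Uq_subset_compl`) — so `E ∖ B` is a spanning member of the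
up-set of `𝓑`, and `B ↦ E ∖ B` injects the bottom sets into the top shadow level: **`#𝓑 ≤ s_p`**
(`card_Uq_le_card_shadowLev_top`). When every bottom set is CLOSED the level-`q` shadow is exactly `𝓑`
(`card_shadowLev_q_eq_card_Uq_of_closed`: a rank-`q` member `A ⊇ B` lies in `cl(B) = B`), so TOP holds:
`s_q ≤ s_p`, and the row (SC) upgrades to (SC) with TOP (`shadowCumulativeTop_of_closed`). PAVING cells (every
circuit with at least `ρ(E)` elements, `q + 2 ≤ p`) have closed bottom sets (`closure_eq_of_mem_Uq_of_paving`: a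
`(q + 1)`-set is independent) and satisfy (SC) (g19's `shadowCumulative_of_paving_tight`), hence (SC) with TOP
(`shadowCumulativeTop_of_paving_tight`); with `RankDistDirectSumTop` / `RankDistDirectSumSC`: **the direct sum of
two paving cells satisfies (SC) with TOP and C-025** (`shadowCumulativeTop_disjointSum_of_paving`,
`rls_disjointSum_of_paving`) — a family of disconnected, non-paving matroids. Nothing here moves any window of
the crux.
-/

namespace PercRepro.RankDist

open Set Finset _root_.Matroid PercRepro.ThmH

variable {α : Type} [DecidableEq α] (M : Matroid α) [M.Finite]

/-! ## The complement of a bottom set contains a bottom set -/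

/-- The complement of any base `B''` containing the bottom set `B` is a bottom set inside `E ∖ B`. -/
lemma exists_mem_Uq_subset_compl {p q : ℕ} (hn : (gr M).card = p + q) (hr : M.eRank = (p : ℕ∞))
    {B : Finset α} (hB : B ∈ PerFlat.Uq M p q) :
    ∃ B' ∈ PerFlat.Uq M p q, (B' : Set α) ⊆ ((gr M \ B : Finset α) : Set α) := by
  classical
  obtain ⟨hBE, hBind, hBq, hbase⟩ := (mem_Uq_tight M hn hr).1 hB
  obtain ⟨B₂, hB₂, hBB₂⟩ := hBind.exists_isBase_superset
  have hB₂E : B₂ ⊆ M.E := hB₂.subset_ground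
  have hB₂fin : B₂.Finite := M.ground_finite.subset hB₂E
  have hB₂card : B₂.ncard = p := by
    have e := hB₂.encard_eq_eRank
    rw [hr, ← hB₂fin.cast_ncard_eq] at e
    exact_mod_cast e
  -- the complement of `B₂`, as a finset
  set B' : Finset α := (gr M).filter (fun x => x ∉ B₂) with hB'
  have hcoe : (B' : Set α) = M.E \ B₂ := by
    rw [hB', Finset.coe_filter]
    ext x
    simp only [Set.mem_setOf_eq, Set.mem_sdiff]
    rw [← Finset.mem_coe, coe_gr]
  have hcompl : ((gr M \ B : Finset α) : Set α) = M.E \ (B : Set α) := by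
    rw [Finset.coe_sdiff, coe_gr]
  have hsub : (B' : Set α) ⊆ ((gr M \ B : Finset α) : Set α) := by
    rw [hcoe, hcompl]
    exact Set.sdiff_subset_sdiff_right hBB₂
  refine ⟨B', ?_, hsub⟩
  rw [mem_Uq_tight M hn hr]
  refine ⟨Finset.filter_subset _ _, ?_, ?_, ?_⟩
  · rw [hcoe]
    exact hbase.indep.subset (by rw [hcompl]; exact Set.sdiff_subset_sdiff_right hBB₂)
  · have h1 : (B' : Set α).ncard = B'.card := Set.ncard_coe_finset B'
    have h2 := Set.ncard_sdiff_add_ncard_of_subset hB₂E M.ground_finite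
    rw [hcoe] at h1
    rw [← card_gr, hn, hB₂card] at h2
    omega
  · have hcompl' : ((gr M \ B' : Finset α) : Set α) = B₂ := by
      rw [Finset.coe_sdiff, coe_gr, hcoe, Set.sdiff_sdiff_cancel_left hB₂E]
    rw [hcompl']
    exact hB₂

/-- The complement of a bottom set is a spanning member of the up-set of the bottom sets. -/
lemma coe_compl_mem_shadowLev_top {p q : ℕ} (hn : (gr M).card = p + q) (hr : M.eRank = (p : ℕ∞))
    {B : Finset α} (hB : B ∈ PerFlat.Uq M p q) :
    ((gr M \ B : Finset α) : Set α) ∈ shadowLev M p (PerFlat.Uq M p q) := by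
  obtain ⟨-, -, -, hbase⟩ := (mem_Uq_tight M hn hr).1 hB
  rw [mem_shadowLev]
  refine ⟨by rw [← coe_gr M]; exact Finset.coe_subset.2 Finset.sdiff_subset, ?_,
    exists_mem_Uq_subset_compl M hn hr hB⟩
  rw [rk_eq_iff M (by rw [← coe_gr M]; exact Finset.coe_subset.2 Finset.sdiff_subset), hbase.spanning.eRk_eq,
    hr]

/-- **`#𝓑 ≤ s_p` on every tight layer**: `B ↦ E ∖ B` injects the bottom sets into the top shadow level. -/
theorem card_Uq_le_card_shadowLev_top {p q : ℕ} (hn : (gr M).card = p + q) (hr : M.eRank = (p : ℕ∞)) :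
    (PerFlat.Uq M p q).card ≤ (shadowLev M p (PerFlat.Uq M p q)).card := by
  refine Finset.card_le_card_of_injOn (fun B => ((gr M \ B : Finset α) : Set α))
    (fun B hB => coe_compl_mem_shadowLev_top M hn hr hB) ?_
  intro B₁ hB₁ B₂ hB₂ h
  rw [Finset.mem_coe] at hB₁ hB₂
  have h1 : gr M \ B₁ = gr M \ B₂ := Finset.coe_injective h
  have hB₁E := (PerFlat.mem_Uq.1 hB₁).1
  have hB₂E := (PerFlat.mem_Uq.1 hB₂).1
  rw [← Finset.sdiff_sdiff_eq_self hB₁E, h1, Finset.sdiff_sdiff_eq_self hB₂E]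

/-! ## Closed bottom sets: the level `q` is `𝓑`, so TOP holds -/

/-- When every bottom set is closed, the level-`q` shadow consists of the bottom sets themselves. -/
lemma card_shadowLev_q_eq_card_Uq_of_closed {p q : ℕ} (hn : (gr M).card = p + q) (hr : M.eRank = (p : ℕ∞))
    (hcl : ∀ B ∈ PerFlat.Uq M p q, M.closure (B : Set α) = B) :
    (shadowLev M q (PerFlat.Uq M p q)).card = (PerFlat.Uq M p q).card := by
  symm
  refine Finset.card_bij (fun B _ => (B : Set α)) (fun B hB => ?_) (fun B₁ _ B₂ _ h => Finset.coe_injective h)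
    (fun A hA => ?_)
  · obtain ⟨hBE, -, hBq, -⟩ := (mem_Uq_tight M hn hr).1 hB
    rw [mem_shadowLev]
    refine ⟨by rw [← coe_gr M]; exact Finset.coe_subset.2 hBE, ?_, B, hB, Set.Subset.refl _⟩
    rw [rk_eq_iff M (by rw [← coe_gr M]; exact Finset.coe_subset.2 hBE)]
    exact (PerFlat.mem_Uq.1 hB).2.1
  · obtain ⟨-, -, B, hB, hBA⟩ := (mem_shadowLev M).1 hA
    refine ⟨B, hB, ?_⟩
    have hsub := subset_closure_of_mem_shadowLev_q M hn hr hA hB hBA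
    rw [hcl B hB] at hsub
    exact Set.Subset.antisymm hBA hsub

/-- **TOP for closed bottom sets, and (SC) upgrades to (SC) with TOP.** -/
theorem shadowCumulativeTop_of_closed {p q : ℕ} (hn : (gr M).card = p + q) (hr : M.eRank = (p : ℕ∞))
    (hcl : ∀ B ∈ PerFlat.Uq M p q, M.closure (B : Set α) = B) (hsc : ShadowCumulative M p q) :
    ShadowCumulativeTop M p q := by
  intro v hqv hvp
  rcases Nat.eq_or_lt_of_le hqv with heq | hqlt
  · rw [← heq]
  rcases Nat.eq_or_lt_of_le hvp with heq | hlt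
  · rw [heq, Nat.choose_symm_add]
    refine Nat.mul_le_mul_right _ ?_
    rw [card_shadowLev_q_eq_card_Uq_of_closed M hn hr hcl]
    exact card_Uq_le_card_shadowLev_top M hn hr
  · exact hsc v hqlt hlt

/-! ## Paving cells: closed bottom sets, (SC) with TOP, and their direct sums -/

/-- In a paving matroid on the tight layer with `q + 2 ≤ p`, every bottom set is closed: a `(q + 1)`-set is
independent. -/
lemma closure_eq_of_mem_Uq_of_paving {p q : ℕ} (hpav : ∀ C, M.IsCircuit C → M.eRank ≤ C.encard)
    (hn : (gr M).card = p + q) (hr : M.eRank = (p : ℕ∞)) (hqp : q + 2 ≤ p) {B : Finset α}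
    (hB : B ∈ PerFlat.Uq M p q) : M.closure (B : Set α) = B := by
  obtain ⟨hBE, hBind, hBq, -⟩ := (mem_Uq_tight M hn hr).1 hB
  have hBE' : (B : Set α) ⊆ M.E := by rw [← coe_gr M]; exact Finset.coe_subset.2 hBE
  refine Set.Subset.antisymm ?_ (M.subset_closure _ hBE')
  intro x hx
  by_contra hxB
  have hxE : x ∈ M.E := M.closure_subset_ground _ hx
  have hind : M.Indep (insert x (B : Set α)) := by
    refine indep_of_encard_lt_eRank M hpav (Set.insert_subset hxE hBE') ?_
    rw [Set.encard_insert_of_notMem hxB, Set.encard_coe_eq_coe_finsetCard, hBq, hr]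
    exact_mod_cast (by omega : q + 1 < p)
  exact (hBind.notMem_closure_iff_of_notMem hxB).2 hind hx

/-- **Paving cells satisfy (SC) with TOP** (`q + 2 ≤ p`). -/
theorem shadowCumulativeTop_of_paving_tight {p q : ℕ} (hpav : ∀ C, M.IsCircuit C → M.eRank ≤ C.encard)
    (hn : (gr M).card = p + q) (hr : M.eRank = (p : ℕ∞)) (hqp : q + 2 ≤ p) : ShadowCumulativeTop M p q :=
  shadowCumulativeTop_of_closed M hn hr (fun _ hB => closure_eq_of_mem_Uq_of_paving M hpav hn hr hqp hB)
    (shadowCumulative_of_paving_tight M hpav hn hr hqp)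

/-- **The direct sum of two paving cells satisfies (SC) with TOP.** -/
theorem shadowCumulativeTop_disjointSum_of_paving (N : Matroid α) [N.Finite] (h : Disjoint M.E N.E)
    [hS : (M.disjointSum N h).Finite] {p₁ q₁ p₂ q₂ : ℕ}
    (hpav₁ : ∀ C, M.IsCircuit C → M.eRank ≤ C.encard) (hn₁ : (gr M).card = p₁ + q₁)
    (hr₁ : M.eRank = (p₁ : ℕ∞)) (hqp₁ : q₁ + 2 ≤ p₁)
    (hpav₂ : ∀ C, N.IsCircuit C → N.eRank ≤ C.encard) (hn₂ : (gr N).card = p₂ + q₂)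
    (hr₂ : N.eRank = (p₂ : ℕ∞)) (hqp₂ : q₂ + 2 ≤ p₂) :
    ShadowCumulativeTop (M.disjointSum N h) (p₁ + p₂) (q₁ + q₂) :=
  shadowCumulativeTop_disjointSum M N h hn₁ hr₁ hn₂ hr₂ (by omega) (by omega)
    (shadowCumulativeTop_of_paving_tight M hpav₁ hn₁ hr₁ hqp₁)
    (shadowCumulativeTop_of_paving_tight N hpav₂ hn₂ hr₂ hqp₂)

/-- **C-025 for the direct sum of two paving cells.** -/
theorem rls_disjointSum_of_paving (N : Matroid α) [N.Finite] (h : Disjoint M.E N.E)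
    [hS : (M.disjointSum N h).Finite] {p₁ q₁ p₂ q₂ : ℕ}
    (hpav₁ : ∀ C, M.IsCircuit C → M.eRank ≤ C.encard) (hn₁ : (gr M).card = p₁ + q₁)
    (hr₁ : M.eRank = (p₁ : ℕ∞)) (hqp₁ : q₁ + 2 ≤ p₁)
    (hpav₂ : ∀ C, N.IsCircuit C → N.eRank ≤ C.encard) (hn₂ : (gr N).card = p₂ + q₂)
    (hr₂ : N.eRank = (p₂ : ℕ∞)) (hqp₂ : q₂ + 2 ≤ p₂) :
    ThmN.RLS (M.disjointSum N h) (p₁ + p₂) (q₁ + q₂) :=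
  rls_of_shadowCumulative _ _ _ (fun v hqv hvp =>
    shadowCumulativeTop_disjointSum_of_paving M N h hpav₁ hn₁ hr₁ hqp₁ hpav₂ hn₂ hr₂ hqp₂ v hqv.le hvp.le)

end PercRepro.RankDist
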